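import Literature.AlgebraicGeometry.Motives.HodgeStructureCentralizerCenterFactorsFieldExtension
import Literature.AlgebraicGeometry.Motives.HodgeStructureLefschetzGroupCenterFieldExtension
import HarnessLib

/-!
# WHEN NO FACTOR OF `C₀ ⊗ K` SPLITS IN `L`: `t_K = t_L` IFF THE CONTRACTION `MaxSpec(Z_L) → MaxSpec(Z_K)` IS A BIJECTION IFF IT IS
# INJECTIVE; THEN `φ` CARRIES PRIMITIVE IDEMPOTENTS TO PRIMITIVE IDEMPOTENTS (`F_i ⊗_k k'` STAYS A FIELD), AND CONVERSELY; ONCE `K`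
# SPLITS `C₀` NOTHING SPLITS FURTHER; FIRST KIND: `Z(S(H)(K)) ≅ Z(S(H)(L))` EXACTLY THEN (Milne 1999 §1 Remark 1.6, §2 p. 646 «`F ⊗_ℚ k = F₁ × ⋯ × F_t`»)

[topic AlgebraicGeometry/Motives]

Layer `Literature/AlgebraicGeometry/Motives`, lane `lit-hodgefound` (Track 2 foundations library; prover seat
`lit-hodgefound-p02`, generation 56, self-proposed row g56-#11). THEOREMS ONLY: no definition, no named fact (net debt `0`),
no instance, no notation.  g56-#1 gave `t_K ≤ t_L`, g56-#2 `#Z(S(H)(K)) = #Z(S(H)(L)) ⟺ t_K = t_L` (first kind), g56-#3 the SURJECTIVE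
contraction `𝔫 ↦ φ⁻¹(𝔫)`, `MaxSpec(Z_L) → MaxSpec(Z_K)`, along any ring homomorphism `φ : Z_K → Z_L` over `j`, with fibres
`{𝔫 | φ(e_𝔪) ∉ 𝔫}`.  The EQUALITY CASE `t_K = t_L` — Milne's decomposition `F ⊗_ℚ k = F₁ × ⋯ × F_t` being already as fine over `k`
as over `k'` — is characterized here (polarizable `H` on a finite-dimensional `V`, fields `ℚ ⊆ K ⊆ L`):
(i) `t_K = t_L` ⟺ the contraction is bijective ⟺ it is injective;
(ii) if it is injective, `φ(e_𝔪)` is the PRIMITIVE idempotent of the unique `𝔫` above `𝔪` (`F_i ⊗_k k'` is a field, `e_i ⊗ 1 = e_{i1}`);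
conversely, if every `φ(e_𝔪)` lies outside exactly one maximal ideal of `Z_L`, then `t_K = t_L`;
(iii) once `K` splits `C₀` (`t_K = dim_ℚ C₀`), `t_L = t_K` for every `L ⊇ K`;
(iv) FIRST KIND: `#Z(S(H)(K)) = #Z(S(H)(L))` — i.e. `γ ↦ γ_L : Z(S(H)(K)) ≅ Z(S(H)(L))`, g56-#2 — iff the contraction is bijective.

## The sources, verbatim

* J. S. Milne, *Lefschetz classes on abelian varieties*, Duke Math. J. 96 (1999) 639–675 [Milne1999LefschetzClasses] (held
  `paper:doi-10-1215-s0012-7094-99-09620-5`): folio 6 = p. 644 L30–L37 (Remark 1.6 «`C'(A) ≅ C(A) ⊗_k k'`, `S'(A) ≅ S(A)_{/k'}`»);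
  folio 7 = p. 645 L2–L14 (`C₀`, `S₀`, Prop. 1.7); folio 8 = p. 646 L33–L38 «Let `F ⊗_ℚ k = F₁ × ⋯ × F_t`, be the decomposition of
  `F ⊗_ℚ k` into a product of fields, and let `1 = e₁ + ⋯ + e_t`, be the corresponding decomposition of `1` into a sum of orthogonal
  idempotents.».
* B. J. J. Moonen, Yu. G. Zarhin, *Weil classes on abelian varieties* [MoonenZarhin1998WeilClasses], §1 Lemma (1).
* R. S. Pierce, *Associative Algebras*, GTM 88 (1982) [Pierce1982], §10.7 Cor. b.

Nearest tree results, BY NAME: g56-#3 `comap_maximalSpectrum_center_centralizer_surjective`, `comap_eq_iff_map_isIdempotentElem_notMem`;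
g56-#1 `natCard_maximalSpectrum_center_centralizer_le`, `natCard_maximalSpectrum_center_centralizer_eq_finrank_center_of_eq`; g56-#2
`Polarization.natCard_center_lefschetzGroupBaseChange_eq_iff_natCard_maximalSpectrum_eq`,
`Polarization.exists_center_lefschetzGroupBaseChange_mulEquiv_of_natCard_maximalSpectrum_eq`; g55-#8
`finite_maximalSpectrum_center_centralizer_endAlg_baseChange`; Mathlib `Nat.bijective_iff_surjective_and_card`.

## Dictionary and what is proved (namespace `Literature.AlgebraicGeometry.Motives.HodgeStructure`)

`Z_K = Subalgebra.center K C(H)(K)`, `t_K = Nat.card (MaximalSpectrum Z_K)`, "`φ` over `j`" = `∀ z x, (φ z).1.1 (j x) = j (z.1.1 x)`.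

* **`comap_maximalSpectrum_bijective_iff_natCard_eq`** (bijective ⟺ `t_K = t_L` ⟺ injective),
  **`map_primitive_of_comap_injective`** (`φ(e_𝔪)` primitive), **`natCard_maximalSpectrum_eq_of_forall_map_primitive`** (converse),
  **`natCard_maximalSpectrum_eq_of_eq_finrank_center`** (`t_K = dim_ℚ C₀ ⟹ t_L = t_K`),
  **`Polarization.natCard_center_lefschetzGroupBaseChange_eq_iff_comap_bijective`** (first kind).
-/

noncomputable section

open scoped TensorProduct

namespace Literature.AlgebraicGeometry.Motives

namespace HodgeStructure

universe u u' v

section Stable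

variable (K : Type u) (L : Type u') [Field K] [Field L] [Algebra ℚ K] [Algebra ℚ L] [Algebra K L]
  [IsScalarTower ℚ K L] {V : Type v} [AddCommGroup V] [Module ℚ V] [Module.Finite ℚ V] {n : ℤ} (H : HodgeStructure V n)

set_option maxSynthPendingDepth 4 in
/-- **`t_K = t_L` IFF NO FACTOR OF `C₀ ⊗ K` SPLITS IN `L`: the contraction `MaxSpec(Z_L) → MaxSpec(Z_K)` (surjective, g56-#3) is a
BIJECTION iff `t_K = t_L`, iff it is injective** (polarizable `H`, any ring homomorphism `φ : Z_K → Z_L` over `j`).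
[cite: Milne1999LefschetzClasses, §1 Remark 1.6 (p. 644) and §2 p. 646 L33–L38] [cite: Pierce1982, §10.7 Cor. b] -/
theorem comap_maximalSpectrum_bijective_iff_natCard_eq (hH : H.IsPolarizable)
    (φ : Subalgebra.center K (Subalgebra.centralizer K
        ((fun a : Module.End ℚ V => a.baseChange K) '' (H.endAlg : Set (Module.End ℚ V)))) →+*
      Subalgebra.center L (Subalgebra.centralizer L
        ((fun a : Module.End ℚ V => a.baseChange L) '' (H.endAlg : Set (Module.End ℚ V)))))
    (hφ : ∀ z x, ((φ z).1.1 : Module.End L (L ⊗[ℚ] V)) (extendScalars K L V x) =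
      extendScalars K L V ((z.1.1 : Module.End K (K ⊗[ℚ] V)) x)) :
    ∃ hmax : ∀ I' : MaximalSpectrum (Subalgebra.center L (Subalgebra.centralizer L
        ((fun a : Module.End ℚ V => a.baseChange L) '' (H.endAlg : Set (Module.End ℚ V))))), (I'.asIdeal.comap φ).IsMaximal,
      (Function.Bijective (fun I' : MaximalSpectrum (Subalgebra.center L (Subalgebra.centralizer L
            ((fun a : Module.End ℚ V => a.baseChange L) '' (H.endAlg : Set (Module.End ℚ V))))) =>
          (⟨I'.asIdeal.comap φ, hmax I'⟩ : MaximalSpectrum (Subalgebra.center K (Subalgebra.centralizer K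
            ((fun a : Module.End ℚ V => a.baseChange K) '' (H.endAlg : Set (Module.End ℚ V))))))) ↔
        Nat.card (MaximalSpectrum (Subalgebra.center K (Subalgebra.centralizer K
            ((fun a : Module.End ℚ V => a.baseChange K) '' (H.endAlg : Set (Module.End ℚ V)))))) =
          Nat.card (MaximalSpectrum (Subalgebra.center L (Subalgebra.centralizer L
            ((fun a : Module.End ℚ V => a.baseChange L) '' (H.endAlg : Set (Module.End ℚ V))))))) ∧
      (Function.Bijective (fun I' : MaximalSpectrum (Subalgebra.center L (Subalgebra.centralizer L
            ((fun a : Module.End ℚ V => a.baseChange L) '' (H.endAlg : Set (Module.End ℚ V))))) =>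
          (⟨I'.asIdeal.comap φ, hmax I'⟩ : MaximalSpectrum (Subalgebra.center K (Subalgebra.centralizer K
            ((fun a : Module.End ℚ V => a.baseChange K) '' (H.endAlg : Set (Module.End ℚ V))))))) ↔
        Function.Injective (fun I' : MaximalSpectrum (Subalgebra.center L (Subalgebra.centralizer L
            ((fun a : Module.End ℚ V => a.baseChange L) '' (H.endAlg : Set (Module.End ℚ V))))) =>
          (⟨I'.asIdeal.comap φ, hmax I'⟩ : MaximalSpectrum (Subalgebra.center K (Subalgebra.centralizer K
            ((fun a : Module.End ℚ V => a.baseChange K) '' (H.endAlg : Set (Module.End ℚ V)))))))) := by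
  obtain ⟨hmax, hsurj⟩ := comap_maximalSpectrum_center_centralizer_surjective K L H hH φ hφ
  haveI := finite_maximalSpectrum_center_centralizer_endAlg_baseChange L (H := H)
  refine ⟨hmax, ?_, ?_⟩
  · rw [Nat.bijective_iff_surjective_and_card]
    exact ⟨fun h => h.2.symm, fun h => ⟨hsurj, h.symm⟩⟩
  · exact ⟨fun h => h.1, fun h => ⟨h, hsurj⟩⟩

set_option maxSynthPendingDepth 4 in
omit [Algebra K L] [IsScalarTower ℚ K L] in
/-- **WHEN `t_K = t_L`, `φ` CARRIES PRIMITIVE IDEMPOTENTS TO PRIMITIVE IDEMPOTENTS**: for the unique `𝔫` above `𝔪`, `φ(e_𝔪) ∉ 𝔫` and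
`φ(e_𝔪) ∈ 𝔫'` for every other `𝔫'` — the factors `F_i ⊗_k k'` stay fields and `e_i ⊗ 1` stays primitive. [cite: Milne1999LefschetzClasses, §1 Remark 1.6 (p. 644) and §2 p. 646 L33–L38]
[cite: Pierce1982, §10.7 Cor. b] -/
theorem map_primitive_of_comap_injective
    (φ : Subalgebra.center K (Subalgebra.centralizer K
        ((fun a : Module.End ℚ V => a.baseChange K) '' (H.endAlg : Set (Module.End ℚ V)))) →+*
      Subalgebra.center L (Subalgebra.centralizer L
        ((fun a : Module.End ℚ V => a.baseChange L) '' (H.endAlg : Set (Module.End ℚ V)))))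
    (hinj : Function.Injective fun I' : MaximalSpectrum (Subalgebra.center L (Subalgebra.centralizer L
        ((fun a : Module.End ℚ V => a.baseChange L) '' (H.endAlg : Set (Module.End ℚ V))))) => I'.asIdeal.comap φ)
    {I : MaximalSpectrum (Subalgebra.center K (Subalgebra.centralizer K
        ((fun a : Module.End ℚ V => a.baseChange K) '' (H.endAlg : Set (Module.End ℚ V)))))}
    {e : Subalgebra.center K (Subalgebra.centralizer K
        ((fun a : Module.End ℚ V => a.baseChange K) '' (H.endAlg : Set (Module.End ℚ V))))}
    (he : IsIdempotentElem e) (heI : e ∉ I.asIdeal)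
    (heJ : ∀ J : MaximalSpectrum (Subalgebra.center K (Subalgebra.centralizer K
        ((fun a : Module.End ℚ V => a.baseChange K) '' (H.endAlg : Set (Module.End ℚ V))))), J ≠ I → e ∈ J.asIdeal)
    {I' : MaximalSpectrum (Subalgebra.center L (Subalgebra.centralizer L
        ((fun a : Module.End ℚ V => a.baseChange L) '' (H.endAlg : Set (Module.End ℚ V)))))}
    (hI' : I'.asIdeal.comap φ = I.asIdeal) :
    IsIdempotentElem (φ e) ∧ φ e ∉ I'.asIdeal ∧
      ∀ J' : MaximalSpectrum (Subalgebra.center L (Subalgebra.centralizer L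
        ((fun a : Module.End ℚ V => a.baseChange L) '' (H.endAlg : Set (Module.End ℚ V))))), J' ≠ I' → φ e ∈ J'.asIdeal := by
  refine ⟨he.map φ, (comap_eq_iff_map_isIdempotentElem_notMem K L H φ I I' heI heJ).1 hI', fun J' hJ' => ?_⟩
  by_contra hmem
  have hJ'I : J'.asIdeal.comap φ = I.asIdeal := (comap_eq_iff_map_isIdempotentElem_notMem K L H φ I J' heI heJ).2 hmem
  exact hJ' (hinj (hJ'I.trans hI'.symm))

set_option maxSynthPendingDepth 4 in
/-- **CONVERSELY: IF EVERY `φ(e_𝔪)` IS PRIMITIVE (lies outside exactly one maximal ideal of `Z_L`), THEN `t_K = t_L`** (the contraction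
is injective: two maximal ideals over the same `𝔪` both miss `φ(e_𝔪)`). [cite: Milne1999LefschetzClasses, §1 Remark 1.6 (p. 644) and §2 p. 646 L33–L38]
[cite: Pierce1982, §10.7 Cor. b] -/
theorem natCard_maximalSpectrum_eq_of_forall_map_primitive (hH : H.IsPolarizable)
    (φ : Subalgebra.center K (Subalgebra.centralizer K
        ((fun a : Module.End ℚ V => a.baseChange K) '' (H.endAlg : Set (Module.End ℚ V)))) →+*
      Subalgebra.center L (Subalgebra.centralizer L
        ((fun a : Module.End ℚ V => a.baseChange L) '' (H.endAlg : Set (Module.End ℚ V)))))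
    (hφ : ∀ z x, ((φ z).1.1 : Module.End L (L ⊗[ℚ] V)) (extendScalars K L V x) =
      extendScalars K L V ((z.1.1 : Module.End K (K ⊗[ℚ] V)) x))
    {e : MaximalSpectrum (Subalgebra.center K (Subalgebra.centralizer K
          ((fun a : Module.End ℚ V => a.baseChange K) '' (H.endAlg : Set (Module.End ℚ V))))) →
        Subalgebra.center K (Subalgebra.centralizer K
          ((fun a : Module.End ℚ V => a.baseChange K) '' (H.endAlg : Set (Module.End ℚ V))))}
    (he : ∀ I, IsIdempotentElem (e I) ∧ e I ∉ I.asIdeal ∧ ∀ J, J ≠ I → e I ∈ J.asIdeal)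
    (hprim : ∀ I, ∀ I' J' : MaximalSpectrum (Subalgebra.center L (Subalgebra.centralizer L
        ((fun a : Module.End ℚ V => a.baseChange L) '' (H.endAlg : Set (Module.End ℚ V))))),
      φ (e I) ∉ I'.asIdeal → φ (e I) ∉ J'.asIdeal → I' = J') :
    Nat.card (MaximalSpectrum (Subalgebra.center K (Subalgebra.centralizer K
        ((fun a : Module.End ℚ V => a.baseChange K) '' (H.endAlg : Set (Module.End ℚ V)))))) =
      Nat.card (MaximalSpectrum (Subalgebra.center L (Subalgebra.centralizer L
        ((fun a : Module.End ℚ V => a.baseChange L) '' (H.endAlg : Set (Module.End ℚ V)))))) := by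
  obtain ⟨hmax, hbij, hbij'⟩ := comap_maximalSpectrum_bijective_iff_natCard_eq K L H hH φ hφ
  refine hbij.1 (hbij'.2 fun I' J' hIJ => ?_)
  have hI : (⟨I'.asIdeal.comap φ, hmax I'⟩ : MaximalSpectrum (Subalgebra.center K (Subalgebra.centralizer K
      ((fun a : Module.End ℚ V => a.baseChange K) '' (H.endAlg : Set (Module.End ℚ V)))))) =
      ⟨J'.asIdeal.comap φ, hmax J'⟩ := hIJ
  set I := (⟨I'.asIdeal.comap φ, hmax I'⟩ : MaximalSpectrum (Subalgebra.center K (Subalgebra.centralizer K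
      ((fun a : Module.End ℚ V => a.baseChange K) '' (H.endAlg : Set (Module.End ℚ V)))))) with hIdef
  have h1 : φ (e I) ∉ I'.asIdeal :=
    (comap_eq_iff_map_isIdempotentElem_notMem K L H φ I I' (he I).2.1 (he I).2.2).1 rfl
  have h2 : φ (e I) ∉ J'.asIdeal :=
    (comap_eq_iff_map_isIdempotentElem_notMem K L H φ I J' (he I).2.1 (he I).2.2).1 (congrArg MaximalSpectrum.asIdeal hI).symm
  exact hprim I I' J' h1 h2

set_option maxSynthPendingDepth 4 in
/-- **ONCE `K` SPLITS `C₀`, NOTHING SPLITS FURTHER: `t_K = dim_ℚ C₀ ⟹ t_L = t_K` for every `L ⊇ K`** (g56-#1: `t_K ≤ t_L ≤ dim_ℚ C₀`), so the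
contraction `MaxSpec(Z_L) → MaxSpec(Z_K)` is then a bijection. [cite: Milne1999LefschetzClasses, §1 Remark 1.6 (p. 644) and §2 p. 646 L33–L38] -/
theorem natCard_maximalSpectrum_eq_of_eq_finrank_center (hH : H.IsPolarizable)
    (hK : Nat.card (MaximalSpectrum (Subalgebra.center K (Subalgebra.centralizer K
        ((fun a : Module.End ℚ V => a.baseChange K) '' (H.endAlg : Set (Module.End ℚ V)))))) =
      Module.finrank ℚ (Subalgebra.center ℚ H.endAlg)) :
    Nat.card (MaximalSpectrum (Subalgebra.center K (Subalgebra.centralizer K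
        ((fun a : Module.End ℚ V => a.baseChange K) '' (H.endAlg : Set (Module.End ℚ V)))))) =
      Nat.card (MaximalSpectrum (Subalgebra.center L (Subalgebra.centralizer L
        ((fun a : Module.End ℚ V => a.baseChange L) '' (H.endAlg : Set (Module.End ℚ V)))))) := by
  rw [hK, natCard_maximalSpectrum_center_centralizer_eq_finrank_center_of_eq K L H hH hK]

set_option maxSynthPendingDepth 4 in
/-- **FIRST KIND: `Z(S(H)(K)) ≅ Z(S(H)(L))` (via `γ ↦ γ_L`) IFF THE CONTRACTION `MaxSpec(Z_L) → MaxSpec(Z_K)` IS A BIJECTION** — `S₀(K) = S₀(L)`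
exactly when no factor of `C₀ ⊗ K` splits in `L` (g56-#2 `#Z(S(H)(K)) = #Z(S(H)(L)) ⟺ t_K = t_L`).
[cite: Milne1999LefschetzClasses, §1 Remark 1.6 (p. 644), p. 645 L2–L14 and §2 p. 646 L33–L38] [cite: MoonenZarhin1998WeilClasses, §1 Lemma (1)] -/
theorem Polarization.natCard_center_lefschetzGroupBaseChange_eq_iff_comap_bijective {H : HodgeStructure V n} (ψ : Polarization H)
    (hfix : ∀ z : H.endAlg, z ∈ Subalgebra.center ℚ H.endAlg → ψ.adjoint (z : Module.End ℚ V) = z)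
    (φ : Subalgebra.center K (Subalgebra.centralizer K
        ((fun a : Module.End ℚ V => a.baseChange K) '' (H.endAlg : Set (Module.End ℚ V)))) →+*
      Subalgebra.center L (Subalgebra.centralizer L
        ((fun a : Module.End ℚ V => a.baseChange L) '' (H.endAlg : Set (Module.End ℚ V)))))
    (hφ : ∀ z x, ((φ z).1.1 : Module.End L (L ⊗[ℚ] V)) (extendScalars K L V x) =
      extendScalars K L V ((z.1.1 : Module.End K (K ⊗[ℚ] V)) x)) :
    ∃ hmax : ∀ I' : MaximalSpectrum (Subalgebra.center L (Subalgebra.centralizer L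
        ((fun a : Module.End ℚ V => a.baseChange L) '' (H.endAlg : Set (Module.End ℚ V))))), (I'.asIdeal.comap φ).IsMaximal,
      Nat.card (Subgroup.center (ψ.lefschetzGroupBaseChange K)) = Nat.card (Subgroup.center (ψ.lefschetzGroupBaseChange L)) ↔
        Function.Bijective (fun I' : MaximalSpectrum (Subalgebra.center L (Subalgebra.centralizer L
            ((fun a : Module.End ℚ V => a.baseChange L) '' (H.endAlg : Set (Module.End ℚ V))))) =>
          (⟨I'.asIdeal.comap φ, hmax I'⟩ : MaximalSpectrum (Subalgebra.center K (Subalgebra.centralizer K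
            ((fun a : Module.End ℚ V => a.baseChange K) '' (H.endAlg : Set (Module.End ℚ V))))))) := by
  obtain ⟨hmax, hbij, -⟩ := comap_maximalSpectrum_bijective_iff_natCard_eq K L H ⟨ψ⟩ φ hφ
  exact ⟨hmax, (ψ.natCard_center_lefschetzGroupBaseChange_eq_iff_natCard_maximalSpectrum_eq K L hfix).trans hbij.symm⟩

end Stable

end HodgeStructure

end Literature.AlgebraicGeometry.Motives
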